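import Summits.CriticalPhenomena.PercolationContinuityZ3.Theorems.Transplant.SkelPhiCorridorStepsF
import Summits.CriticalPhenomena.PercolationContinuityZ3.Theorems.Transplant.SkelRootSeedLawF
import Summits.CriticalPhenomena.PercolationContinuityZ3.Theorems.Transplant.KNCells2RootChain
import HarnessLib

/-!
# N2 (frames-only node `SamePDropOfSkeletonFrm₁`, OPEN), (R) column ((R-26), design owner p3-g15): **THE ROOT LEG OF ONE ONWARD DIRECTION AS ONE
# SCHEDULE WITH PARKING FROM THE FAT SEED, IN THE SHAPE OF `Skel.RootOblTWF`** — `Skelφ.rootChainF_of_sched`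

For ANY anchored scheme `S : KSchA V A`, a direction `du`, ANY schedule with parking `Sc : ChainPlanar.ScheduleNP` read in one x-run frame `runX φ c₀ n hs σ`
through the PLAIN ball window about `w₀` (radius `R`), and the root-seed law `W := S.W0pin G F U'` (the seed's pairs `F ⊆ U₀` pinned open, the world
`U' := (Q₀ ∪ E_{0,du}) ∩ B(w₀, R)` honest): the (S0) chain `chainF_of_seg ∘ hkits_schedF` (p5-g15, SkelPhiCorridorChainF / SkelPhiCorridorStepsF) with source
box `B₀ := Win ψ w₀ (core 0) R`, plus the two root clauses of N1's (R) column — the TRANSFER `KSchA.real_W0pin_le_rootLaw` (pinning fewer cube pairs open only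
lowers increasing root events; restriction turns `↔` into `↔ inside Q₀ ∪ E_{0,du}`) and the SOURCE REACH `Skel.root_hsrc_of_pinned` (one link from the
internally connected, wired seed into the first core window) — gives the body of `Skel.RootOblTWF G S Δ' δr du` (SkelRootSeedLawF p340132) at accuracy `δ`,
centre `w₀`, depth `R`, `n := Sc.N`.  The per-step per-centre PARKED-OR-ROUTED input `hrouteS` is taken as a hypothesis in `hkits_schedF`'s shape (for the
K-G corridor of record it is p5-g15's `hrouteSW_kgCorr(Y)`); the vertex-form rows (`hreg` world, `hdis` seed clearance, `hcover`, `hTne`, `hlastM`, `hexc`)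
are the Γ rows of the root cell, discharged at `cellGeomSG₂S` by the Geom pens exactly as for the (C) capstone `reachChainF_of_kgCorr` (p344745).
builds on p205010 (kernel theorem, internal audit signed; external expert review pending) — nothing in this file uses p205010; nothing here is a
claim about the open node `SamePDropOfSkeletonFrm₁`.
Lane `prim-bschramm`, seat `prim-bschramm-p3` (gen 15; N2 design owner, (R) column owner); helper file (`--supports stmt-CriticalPhenomena-4575 --as helper`).
[cite: KozmaNitzan2024, §4 p. 27 (G₀), p. 28 ((32) at the root, "positively correlated by the FKG inequality"), Lemma 11 (pp. 22–23), Lemma 12 (pp. 23–25)]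
[cite: MartineauTassion2017, §4.3 Lemma 4.2]
-/

noncomputable section

open MeasureTheory ProbabilityTheory
open scoped ENNReal Classical

namespace Summit.CriticalPhenomena.PercolationContinuityZ3.Theorems

namespace Transplant

namespace Skelφ

open Literature.Probability.Percolation Literature.Probability.LatticeModels SimpleGraph GadgetSystem ProbeHistory HSiteScheme Contour KNCells
open KNCells.KSchA KNLevels ChainPlanar ChainPara
open Literature.Barriers.CriticalPhenomena (graphBall graphBall_mono)
open Skel (winGraph)
open SkelI (tanOff)

variable {V : Type} [DecidableEq V] [Countable V] {G : SimpleGraph V} [G.LocallyFinite] {φ : V → Site 2}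

/-- **THE ROOT LEG OF ONE DIRECTION AS ONE SCHEDULE WITH PARKING FROM THE FAT SEED, `RootOblTWF` SHAPE** (roles of the hypotheses in the module
docstring; the conclusion is the body of `Skel.RootOblTWF G S Δ' δr du` with `δr n := δ`, centre `w₀`, depth `R`, law `S.W0pin G F U'`).
[cite: KozmaNitzan2024, §4 p. 28 ((32) at the root), Lemma 12 (pp. 23–25)] [this work] -/
theorem rootChainF_of_sched
    -- the scheme, the direction
    {A : Type*} {S : KSchA V A} (du : MDir)
    -- the skeleton map, the frame
    (hlipφ : Lip G φ) (hstep : Steps G φ) {Δ : ℕ} (hΔ : ∀ v, G.degree v ≤ Δ) {types : Finset V} (hfr : Frames G φ types) (hκ : CylConn G φ types)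
    {n : ℕ} {hs : ℤ} (hn : 1 ≤ n) (c₀ : V) {σ : ℤ} (hσ : σ = 1 ∨ σ = -1) {kq : ℕ} (hκL : hs.natAbs ≤ kq * n)
    -- the schedule, the window
    (Sc : ScheduleNP) {w₀ : V} {R r : ℕ}
    -- kit constants
    (Pk : ApronPrm) {Mz Rs KCmax rs cS cU : ℕ} (hPN : kq + 3 ≤ Pk.N) (hA : Pk.A = (Mz + 1 : ℕ) * (shearUnit n hs : ℤ) + 1)
    (hdD : Pk.d + 2 ≤ shellD Pk) (hDρ : Rs + 1 ≤ shellD Pk) (hKCmax : (shellD Pk + Mz + 1) * (kq + 1) ≤ KCmax)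
    (hT : (shellD Pk : ℤ) + KCmax + Rs ≤ tanOff Pk.ℓs Pk.M)
    (hr₀ : Pk.N * (tanOff Pk.ℓs Pk.M + 2) + Pk.N * Pk.d + (KCmax + Rs) ≤ Pk.r₀) (hR : Pk.r₀ ≤ R)
    (hrs : 1 + (Pk.N * (tanOff Pk.ℓs Pk.M + 2) + Pk.N * Pk.d + (KCmax + Rs)) ≤ rs)
    (hcS : (Pk.N + 1) * (tanOff Pk.ℓs Pk.M + 1) + (Pk.N + 1) * Pk.d + (KCmax + 1) + cU ≤ cS)
    (hreach : r + (Pk.N * (tanOff Pk.ℓs Pk.M + 1) + Pk.N * Pk.d + KCmax) ≤ Pk.r₀)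
    -- the short region and the zone datum
    (Rg : V → Finset V) (hRg : ∀ c, ∀ u ∈ Rg c, u ∈ graphBall G c Rs) (hRgcard : ∀ c, (Rg c).card ≤ cU) (hcU1 : 1 ≤ cU)
    (Λc : V → ℕ → Finset V) (kz : ℕ) (hΛRg : ∀ c, Λc c kz ⊆ Rg c) (hzconn : ∀ c, ∀ s ∈ Λc c kz, PathIn G (↑(Λc c kz) : Set V) c s)
    (hcz : ∀ c, c ∈ Λc c kz) {Rk : ℕ} (hkz : 1 ≤ kz) (hRk : cylRadMax G φ types kz (2 * KCmax) ≤ Rk) (hΛcyl : ∀ c, cylBallFin G φ c kz Rk ⊆ Λc c kz)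
    -- the chain data (world `U' := (Q₀ ∪ E_{0,du}) ∩ B(w₀, R)`)
    (Pd : WinChainData V) (hPo : Pd.o = S.Γ.root) (hPS : Pd.Sfin = (S.U0root du).filter fun y => y ∈ graphBall G w₀ R)
    (hj0 : tanOff Pk.ℓs Pk.M ≤ Pd.j₀) (hj : Pd.j₁ ≤ Pd.Rlev) (hRl : Pd.Rlev + 1 ≤ Sc.R')
    (hE : Pd.j₁ + (Pk.N * (tanOff Pk.ℓs Pk.M + 1) + Pk.N * Pk.d + KCmax) ≤ Sc.R')
    {Δ' : ℕ} {δ η : ℝ} (hδ : 0 < δ) (hη : η ≤ δ / 2)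
    (kk : ℕ) (hN : kk * (Δ + 1) ^ (2 * rs) ≤ Pd.N) (hk : (1 - (S.p : ℝ) ^ (1 + Δ * cS + cS * cU)) ^ kk ≤ δ)
    (hcount : 1 / (1 - (S.p : ℝ)) ^ (Δ' * Pd.N) ≤ δ * ((Finset.Icc Pd.j₀ Pd.j₁).card : ℝ))
    -- the fat seed: its pairs `F ⊆ U₀` (pinned), its vertices `Sw` (internally connected to the root, wired by `F`), the hop into the first core window
    {F : Finset (Sym2 V)} {Sw Qp Sd : Finset V} (hF : F ⊆ S.U₀ G) (hFSw : ∀ e ∈ F, ∀ w ∈ e, w ∈ Sw)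
    (hSwU : Sw ⊆ (S.U0root du).filter fun y => y ∈ graphBall G w₀ R) (hQU : Qp ⊆ (S.U0root du).filter fun y => y ∈ graphBall G w₀ R)
    (hSd : Sd ⊆ Sw) (hconn : ∀ s ∈ Sw, PathIn G (↑Sw : Set V) S.Γ.root s)
    (hwired : ∀ u ∈ Sw, ∀ u' ∈ Sw, G.Adj u u' → s(u, u') ∈ F) (hrootSw : S.Γ.root ∈ Sw)
    (hlink : 1 - δ < (bondPercolation G S.p).real (linkIn (↑Qp : Set V) Sd (Win G (runX φ c₀ n hs σ) w₀ (ScheduleNP.core Sc 0) R)))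
    -- the world rows (vertex form): every region window lies in `Q₀ ∪ E_{0,du}` and clears the seed; the rim; depth; the arrival cube
    (hreg : ∀ k ≤ Sc.N, ∀ u ∈ graphBall G w₀ R, runX φ c₀ n hs σ u ∈ Sc.region k → u ∈ S.U0root du)
    (hdis : ∀ k ≤ Sc.N, Disjoint (Win G (runX φ c₀ n hs σ) w₀ (Sc.region k) R) Sw)
    (hRim : ∀ k, Pd.Rim k ⊆ Win G (runX φ c₀ n hs σ) w₀ (Sc.region k) R)
    (hcover : ∀ k ≤ Sc.N, ∀ v ∈ Win G (runX φ c₀ n hs σ) w₀ (Sc.region k) R, v ∉ graphBall G w₀ (R - Pk.r₀) → v ∈ Pd.Rim k)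
    (hTne : ∀ k ≤ Sc.N, (Win G (runX φ c₀ n hs σ) w₀ (ScheduleNP.core Sc (k + 1)) R).Nonempty)
    (hlastM : ∀ u ∈ graphBall G w₀ R, runX φ c₀ n hs σ u ∈ ScheduleNP.core Sc (Sc.N + 1) → u ∈ S.Γ.M S.Γ.a₀ ((0 : Site 2) + stepVec du))
    (hexc : ∀ k ≤ Sc.N,
      (prodBernoulli (S.W0pin G F ((S.U0root du).filter fun y => y ∈ graphBall G w₀ R))).real (⋃ t' ∈ Pd.Rim k, openConn S.Γ.root t') ≤ η)
    -- THE PER-STEP PER-CENTRE PARKED-OR-ROUTED INPUT under the root-seed law (for the K-G corridor: p5-g15's `hrouteSW_kgCorr(Y)`)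
    (hrouteS : ∀ k ≤ Sc.N, ∀ c : V,
      runX φ c₀ n hs σ c ∈ Finset.Icc (Sc.lo k - ((Sc.R' : ℕ) : Site 2)) (Sc.hi k + ((Sc.R' : ℕ) : Site 2)) → c ∈ graphBall G w₀ (R - r) →
      c ∈ Win G (runX φ c₀ n hs σ) w₀ (ScheduleNP.core Sc (k + 1)) R ∪ Pd.Rim k ∨
      ∃ Qt Ft : Finset V, Ft ⊆ Win G (runX φ c₀ n hs σ) w₀ (ScheduleNP.core Sc (k + 1)) R ∪ Pd.Rim k ∧
        Qt ⊆ Win G (runX φ c₀ n hs σ) w₀ (Sc.region k) R ∧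
        1 - δ ^ 3 ≤ (prodBernoulli (S.W0pin G F ((S.U0root du).filter fun y => y ∈ graphBall G w₀ R))).real
          (linkIn (↑Qt : Set V) (Λc c kz) Ft)) :
    ∃ (n₀ : ℕ) (c : V) (Rπ : ℕ) (W : Sym2 V → unitInterval) (s : Fin (n₀ + 1) → KNLevels.TStep (winGraph G c Rπ))
      (T' : Fin (n₀ + 1) → Finset V) (η' : ℝ),
      (∀ T : Finset V, (prodBernoulli W).real (⋃ t ∈ T, openConn S.Γ.root t) ≤
        (prodBernoulli (pinW (KNLevels.lattW G S.p) ↑(S.U₀ G) ↑(S.U₀ G))).real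
          (⋃ t ∈ (↑T : Set V), openConnIn (↑(S.Γ.Q S.Γ.a₀ 0 ∪ S.Γ.Ewv S.Γ.a₀ 0 du) : Set V) S.Γ.root t)) ∧
      (∀ i : Fin (n₀ + 1), (s i).L.o = S.Γ.root) ∧
      (∀ i : Fin n₀, T' (Fin.castSucc i) ⊆ (s i.succ).L.X 0) ∧ (∀ i : Fin (n₀ + 1), T' i ⊆ (s i).T) ∧
      (∀ i : Fin (n₀ + 1), (s i).KitsAtF W S.p Δ' δ) ∧ η' ≤ δ / 2 ∧
      (∀ i : Fin (n₀ + 1), (prodBernoulli W).real (⋃ t ∈ (s i).T \ T' i, openConn S.Γ.root t) ≤ η') ∧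
      1 - δ < (prodBernoulli W).real (s 0).L.reachB ∧
      T' (Fin.last n₀) ⊆ S.Γ.M S.Γ.a₀ ((0 : Site 2) + stepVec du) := by
  set ψ := runX φ c₀ n hs σ with hψ
  set U' : Finset V := (S.U0root du).filter fun y => y ∈ graphBall G w₀ R with hU'
  set W := S.W0pin G F U' with hW
  set 𝒲 := planarWindowWin (lip_runX hlipφ hσ hn c₀ hs) w₀ R with h𝒲def
  have hU'sub : U' ⊆ S.U0root du := Finset.filter_subset _ _
  have hrootU : S.Γ.root ∈ U' := hSwU hrootSw
  -- windows lie in the world, and clear the seed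
  have hWinU : ∀ k ≤ Sc.N, Win G ψ w₀ (Sc.region k) R ⊆ U' := by
    intro k hk u hu
    obtain ⟨hub, huR⟩ := (mem_Win (G := G) (φ := ψ)).1 hu
    exact Finset.mem_filter.2 ⟨hreg k hk u hub huR, hub⟩
  have hsub : ∀ k ≤ Sc.N, IsSubbox (winGraph G w₀ R) W S.p (𝒲.stepDF Sc.toFrame k) := by
    intro k hk
    rw [stepDF_toFrame_win_eq]
    exact Skel.isSubbox_W0pin_win (S := S) w₀ R (hWinU k hk) (fresh_of_disjoint hFSw (hdis k hk))
  -- the per-step clauses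
  have hj1R : Pd.j₁ ≤ Sc.R' := by omega
  have hr₀1 : r ≤ Pk.r₀ := by omega
  have hkits := hkits_schedF hlipφ hstep hΔ hδ hn c₀ hs hσ hκL Sc Pk hPN hA hdD hDρ hKCmax hT hr₀ hR hrs hcS hreach Rg hRg hRgcard
    hcU1 Λc kz hΛRg hzconn hcz hfr hκ hkz hRk hΛcyl Pd hj0 hj1R hE kk hN hk hcover hrouteS
  -- the one-segment chain in residue shape
  have hfin : FinSupp W Pd.Sfin := by rw [hPS]; exact finSupp_W0pin
  have hDS : ∀ k ≤ Sc.N, 𝒲.stepDF Sc.toFrame k ⊆ Pd.Sfin := fun k hk u hu => by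
    rw [hPS]; rw [stepDF_toFrame_win_eq] at hu; exact hWinU k hk hu
  have ho : ∀ k ≤ Sc.N, Pd.o ∉ 𝒲.stepDF Sc.toFrame k := fun k hk hmem => by
    rw [hPo, stepDF_toFrame_win_eq] at hmem
    exact Finset.disjoint_left.1 (hdis k hk) hmem hrootSw
  have hoS : Pd.o ∈ Pd.Sfin := by rw [hPo, hPS]; exact hrootU
  have hRim' : ∀ k, Pd.Rim k ⊆ 𝒲.stepDF Sc.toFrame k := fun k => by rw [stepDF_toFrame_win_eq]; exact hRim k
  have hTne' : ∀ k ≤ Sc.N, (𝒲.coreTF Sc.toFrame k).Nonempty := fun k hk => hTne k hk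
  have hB₀ : Win G ψ w₀ (ScheduleNP.core Sc 0) R ⊆ 𝒲.W (Sc.toFrame.core 0) := subset_rfl
  obtain ⟨s, T', ho', hlink', hsubT, hkitsF, hexcF, h0, hlast⟩ := Pd.chainF_of_seg 𝒲 Sc.toFrame hRl hRim' hTne' hsub hfin hDS ho hoS hj hcount
    hkits (fun k hk => by rw [hPo]; exact hexc k hk) hB₀
  refine ⟨Sc.N, w₀, R, W, s, T', η, fun T => real_W0pin_le_rootLaw hF hU'sub hrootU T, fun i => (ho' i).trans hPo, hlink', hsubT, hkitsF, hη,
    fun i => by rw [← hPo]; exact hexcF i, ?_, ?_⟩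
  · -- the source reach: the seed is wired open and joined to the root; one link into the first core window, which lies in `X^{(0)}_0`
    have hsrc := Skel.root_hsrc_of_pinned (S := S) (G := G) (F := F) (o := S.Γ.root) hlink hQU hSwU hSd hconn hwired
    refine hsrc.trans_le (measureReal_mono ?_ (measure_ne_top _ _))
    have ho0 : (s (0 : Fin (Sc.N + 1))).L.o = S.Γ.root := (ho' _).trans hPo
    have h0' : Win G ψ w₀ (ScheduleNP.core Sc 0) R ⊆ (s (0 : Fin (Sc.N + 1))).L.X 0 := h0
    intro ω hω
    unfold LData.reachB
    simp only [Set.mem_iUnion, exists_prop] at hω ⊢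
    obtain ⟨t, ht, hωt⟩ := hω
    exact ⟨t, h0' (Finset.mem_coe.1 ht), by rw [ho0]; exact hωt⟩
  · have hlast' : T' (Fin.last Sc.N) = 𝒲.W (Sc.toFrame.core (Sc.N + 1)) := hlast
    rw [hlast']
    intro u hu
    obtain ⟨hub, huC⟩ := (mem_Win (G := G) (φ := ψ)).1 hu
    exact hlastM u hub huC

/-- **The root leg with its LENGTH EXPOSED** (`n := Sc.N`, the number of steps of the schedule): the statement of `rootChainF_of_sched` with the
existential length replaced by `Sc.N` — what the (R) wrapper needs to serve the FLAT root table `κ.δr n = κ.δr 0` (`FlatQ`, `n ≤ Lf K₀`) at the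
chain's own length (design owner p3-g16; same proof). [cite: KozmaNitzan2024, §4 p. 28 ((32) at the root), Lemma 12 (pp. 23–25)] [this work] -/
theorem rootChainF_of_schedN
    -- the scheme, the direction
    {A : Type*} {S : KSchA V A} (du : MDir)
    -- the skeleton map, the frame
    (hlipφ : Lip G φ) (hstep : Steps G φ) {Δ : ℕ} (hΔ : ∀ v, G.degree v ≤ Δ) {types : Finset V} (hfr : Frames G φ types) (hκ : CylConn G φ types)
    {n : ℕ} {hs : ℤ} (hn : 1 ≤ n) (c₀ : V) {σ : ℤ} (hσ : σ = 1 ∨ σ = -1) {kq : ℕ} (hκL : hs.natAbs ≤ kq * n)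
    -- the schedule, the window
    (Sc : ScheduleNP) {w₀ : V} {R r : ℕ}
    -- kit constants
    (Pk : ApronPrm) {Mz Rs KCmax rs cS cU : ℕ} (hPN : kq + 3 ≤ Pk.N) (hA : Pk.A = (Mz + 1 : ℕ) * (shearUnit n hs : ℤ) + 1)
    (hdD : Pk.d + 2 ≤ shellD Pk) (hDρ : Rs + 1 ≤ shellD Pk) (hKCmax : (shellD Pk + Mz + 1) * (kq + 1) ≤ KCmax)
    (hT : (shellD Pk : ℤ) + KCmax + Rs ≤ tanOff Pk.ℓs Pk.M)
    (hr₀ : Pk.N * (tanOff Pk.ℓs Pk.M + 2) + Pk.N * Pk.d + (KCmax + Rs) ≤ Pk.r₀) (hR : Pk.r₀ ≤ R)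
    (hrs : 1 + (Pk.N * (tanOff Pk.ℓs Pk.M + 2) + Pk.N * Pk.d + (KCmax + Rs)) ≤ rs)
    (hcS : (Pk.N + 1) * (tanOff Pk.ℓs Pk.M + 1) + (Pk.N + 1) * Pk.d + (KCmax + 1) + cU ≤ cS)
    (hreach : r + (Pk.N * (tanOff Pk.ℓs Pk.M + 1) + Pk.N * Pk.d + KCmax) ≤ Pk.r₀)
    -- the short region and the zone datum
    (Rg : V → Finset V) (hRg : ∀ c, ∀ u ∈ Rg c, u ∈ graphBall G c Rs) (hRgcard : ∀ c, (Rg c).card ≤ cU) (hcU1 : 1 ≤ cU)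
    (Λc : V → ℕ → Finset V) (kz : ℕ) (hΛRg : ∀ c, Λc c kz ⊆ Rg c) (hzconn : ∀ c, ∀ s ∈ Λc c kz, PathIn G (↑(Λc c kz) : Set V) c s)
    (hcz : ∀ c, c ∈ Λc c kz) {Rk : ℕ} (hkz : 1 ≤ kz) (hRk : cylRadMax G φ types kz (2 * KCmax) ≤ Rk) (hΛcyl : ∀ c, cylBallFin G φ c kz Rk ⊆ Λc c kz)
    -- the chain data (world `U' := (Q₀ ∪ E_{0,du}) ∩ B(w₀, R)`)
    (Pd : WinChainData V) (hPo : Pd.o = S.Γ.root) (hPS : Pd.Sfin = (S.U0root du).filter fun y => y ∈ graphBall G w₀ R)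
    (hj0 : tanOff Pk.ℓs Pk.M ≤ Pd.j₀) (hj : Pd.j₁ ≤ Pd.Rlev) (hRl : Pd.Rlev + 1 ≤ Sc.R')
    (hE : Pd.j₁ + (Pk.N * (tanOff Pk.ℓs Pk.M + 1) + Pk.N * Pk.d + KCmax) ≤ Sc.R')
    {Δ' : ℕ} {δ η : ℝ} (hδ : 0 < δ) (hη : η ≤ δ / 2)
    (kk : ℕ) (hN : kk * (Δ + 1) ^ (2 * rs) ≤ Pd.N) (hk : (1 - (S.p : ℝ) ^ (1 + Δ * cS + cS * cU)) ^ kk ≤ δ)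
    (hcount : 1 / (1 - (S.p : ℝ)) ^ (Δ' * Pd.N) ≤ δ * ((Finset.Icc Pd.j₀ Pd.j₁).card : ℝ))
    -- the fat seed: its pairs `F ⊆ U₀` (pinned), its vertices `Sw` (internally connected to the root, wired by `F`), the hop into the first core window
    {F : Finset (Sym2 V)} {Sw Qp Sd : Finset V} (hF : F ⊆ S.U₀ G) (hFSw : ∀ e ∈ F, ∀ w ∈ e, w ∈ Sw)
    (hSwU : Sw ⊆ (S.U0root du).filter fun y => y ∈ graphBall G w₀ R) (hQU : Qp ⊆ (S.U0root du).filter fun y => y ∈ graphBall G w₀ R)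
    (hSd : Sd ⊆ Sw) (hconn : ∀ s ∈ Sw, PathIn G (↑Sw : Set V) S.Γ.root s)
    (hwired : ∀ u ∈ Sw, ∀ u' ∈ Sw, G.Adj u u' → s(u, u') ∈ F) (hrootSw : S.Γ.root ∈ Sw)
    (hlink : 1 - δ < (bondPercolation G S.p).real (linkIn (↑Qp : Set V) Sd (Win G (runX φ c₀ n hs σ) w₀ (ScheduleNP.core Sc 0) R)))
    -- the world rows (vertex form): every region window lies in `Q₀ ∪ E_{0,du}` and clears the seed; the rim; depth; the arrival cube
    (hreg : ∀ k ≤ Sc.N, ∀ u ∈ graphBall G w₀ R, runX φ c₀ n hs σ u ∈ Sc.region k → u ∈ S.U0root du)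
    (hdis : ∀ k ≤ Sc.N, Disjoint (Win G (runX φ c₀ n hs σ) w₀ (Sc.region k) R) Sw)
    (hRim : ∀ k, Pd.Rim k ⊆ Win G (runX φ c₀ n hs σ) w₀ (Sc.region k) R)
    (hcover : ∀ k ≤ Sc.N, ∀ v ∈ Win G (runX φ c₀ n hs σ) w₀ (Sc.region k) R, v ∉ graphBall G w₀ (R - Pk.r₀) → v ∈ Pd.Rim k)
    (hTne : ∀ k ≤ Sc.N, (Win G (runX φ c₀ n hs σ) w₀ (ScheduleNP.core Sc (k + 1)) R).Nonempty)
    (hlastM : ∀ u ∈ graphBall G w₀ R, runX φ c₀ n hs σ u ∈ ScheduleNP.core Sc (Sc.N + 1) → u ∈ S.Γ.M S.Γ.a₀ ((0 : Site 2) + stepVec du))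
    (hexc : ∀ k ≤ Sc.N,
      (prodBernoulli (S.W0pin G F ((S.U0root du).filter fun y => y ∈ graphBall G w₀ R))).real (⋃ t' ∈ Pd.Rim k, openConn S.Γ.root t') ≤ η)
    -- THE PER-STEP PER-CENTRE PARKED-OR-ROUTED INPUT under the root-seed law (for the K-G corridor: p5-g15's `hrouteSW_kgCorr(Y)`)
    (hrouteS : ∀ k ≤ Sc.N, ∀ c : V,
      runX φ c₀ n hs σ c ∈ Finset.Icc (Sc.lo k - ((Sc.R' : ℕ) : Site 2)) (Sc.hi k + ((Sc.R' : ℕ) : Site 2)) → c ∈ graphBall G w₀ (R - r) →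
      c ∈ Win G (runX φ c₀ n hs σ) w₀ (ScheduleNP.core Sc (k + 1)) R ∪ Pd.Rim k ∨
      ∃ Qt Ft : Finset V, Ft ⊆ Win G (runX φ c₀ n hs σ) w₀ (ScheduleNP.core Sc (k + 1)) R ∪ Pd.Rim k ∧
        Qt ⊆ Win G (runX φ c₀ n hs σ) w₀ (Sc.region k) R ∧
        1 - δ ^ 3 ≤ (prodBernoulli (S.W0pin G F ((S.U0root du).filter fun y => y ∈ graphBall G w₀ R))).real
          (linkIn (↑Qt : Set V) (Λc c kz) Ft)) :
    ∃ (c : V) (Rπ : ℕ) (W : Sym2 V → unitInterval) (s : Fin (Sc.N + 1) → KNLevels.TStep (winGraph G c Rπ))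
      (T' : Fin (Sc.N + 1) → Finset V) (η' : ℝ),
      (∀ T : Finset V, (prodBernoulli W).real (⋃ t ∈ T, openConn S.Γ.root t) ≤
        (prodBernoulli (pinW (KNLevels.lattW G S.p) ↑(S.U₀ G) ↑(S.U₀ G))).real
          (⋃ t ∈ (↑T : Set V), openConnIn (↑(S.Γ.Q S.Γ.a₀ 0 ∪ S.Γ.Ewv S.Γ.a₀ 0 du) : Set V) S.Γ.root t)) ∧
      (∀ i : Fin (Sc.N + 1), (s i).L.o = S.Γ.root) ∧
      (∀ i : Fin Sc.N, T' (Fin.castSucc i) ⊆ (s i.succ).L.X 0) ∧ (∀ i : Fin (Sc.N + 1), T' i ⊆ (s i).T) ∧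
      (∀ i : Fin (Sc.N + 1), (s i).KitsAtF W S.p Δ' δ) ∧ η' ≤ δ / 2 ∧
      (∀ i : Fin (Sc.N + 1), (prodBernoulli W).real (⋃ t ∈ (s i).T \ T' i, openConn S.Γ.root t) ≤ η') ∧
      1 - δ < (prodBernoulli W).real (s 0).L.reachB ∧
      T' (Fin.last Sc.N) ⊆ S.Γ.M S.Γ.a₀ ((0 : Site 2) + stepVec du) := by
  set ψ := runX φ c₀ n hs σ with hψ
  set U' : Finset V := (S.U0root du).filter fun y => y ∈ graphBall G w₀ R with hU'
  set W := S.W0pin G F U' with hW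
  set 𝒲 := planarWindowWin (lip_runX hlipφ hσ hn c₀ hs) w₀ R with h𝒲def
  have hU'sub : U' ⊆ S.U0root du := Finset.filter_subset _ _
  have hrootU : S.Γ.root ∈ U' := hSwU hrootSw
  -- windows lie in the world, and clear the seed
  have hWinU : ∀ k ≤ Sc.N, Win G ψ w₀ (Sc.region k) R ⊆ U' := by
    intro k hk u hu
    obtain ⟨hub, huR⟩ := (mem_Win (G := G) (φ := ψ)).1 hu
    exact Finset.mem_filter.2 ⟨hreg k hk u hub huR, hub⟩
  have hsub : ∀ k ≤ Sc.N, IsSubbox (winGraph G w₀ R) W S.p (𝒲.stepDF Sc.toFrame k) := by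
    intro k hk
    rw [stepDF_toFrame_win_eq]
    exact Skel.isSubbox_W0pin_win (S := S) w₀ R (hWinU k hk) (fresh_of_disjoint hFSw (hdis k hk))
  -- the per-step clauses
  have hj1R : Pd.j₁ ≤ Sc.R' := by omega
  have hr₀1 : r ≤ Pk.r₀ := by omega
  have hkits := hkits_schedF hlipφ hstep hΔ hδ hn c₀ hs hσ hκL Sc Pk hPN hA hdD hDρ hKCmax hT hr₀ hR hrs hcS hreach Rg hRg hRgcard
    hcU1 Λc kz hΛRg hzconn hcz hfr hκ hkz hRk hΛcyl Pd hj0 hj1R hE kk hN hk hcover hrouteS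
  -- the one-segment chain in residue shape
  have hfin : FinSupp W Pd.Sfin := by rw [hPS]; exact finSupp_W0pin
  have hDS : ∀ k ≤ Sc.N, 𝒲.stepDF Sc.toFrame k ⊆ Pd.Sfin := fun k hk u hu => by
    rw [hPS]; rw [stepDF_toFrame_win_eq] at hu; exact hWinU k hk hu
  have ho : ∀ k ≤ Sc.N, Pd.o ∉ 𝒲.stepDF Sc.toFrame k := fun k hk hmem => by
    rw [hPo, stepDF_toFrame_win_eq] at hmem
    exact Finset.disjoint_left.1 (hdis k hk) hmem hrootSw
  have hoS : Pd.o ∈ Pd.Sfin := by rw [hPo, hPS]; exact hrootU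
  have hRim' : ∀ k, Pd.Rim k ⊆ 𝒲.stepDF Sc.toFrame k := fun k => by rw [stepDF_toFrame_win_eq]; exact hRim k
  have hTne' : ∀ k ≤ Sc.N, (𝒲.coreTF Sc.toFrame k).Nonempty := fun k hk => hTne k hk
  have hB₀ : Win G ψ w₀ (ScheduleNP.core Sc 0) R ⊆ 𝒲.W (Sc.toFrame.core 0) := subset_rfl
  obtain ⟨s, T', ho', hlink', hsubT, hkitsF, hexcF, h0, hlast⟩ := Pd.chainF_of_seg 𝒲 Sc.toFrame hRl hRim' hTne' hsub hfin hDS ho hoS hj hcount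
    hkits (fun k hk => by rw [hPo]; exact hexc k hk) hB₀
  refine ⟨w₀, R, W, s, T', η, fun T => real_W0pin_le_rootLaw hF hU'sub hrootU T, fun i => (ho' i).trans hPo, hlink', hsubT, hkitsF, hη,
    fun i => by rw [← hPo]; exact hexcF i, ?_, ?_⟩
  · -- the source reach: the seed is wired open and joined to the root; one link into the first core window, which lies in `X^{(0)}_0`
    have hsrc := Skel.root_hsrc_of_pinned (S := S) (G := G) (F := F) (o := S.Γ.root) hlink hQU hSwU hSd hconn hwired
    refine hsrc.trans_le (measureReal_mono ?_ (measure_ne_top _ _))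
    have ho0 : (s (0 : Fin (Sc.N + 1))).L.o = S.Γ.root := (ho' _).trans hPo
    have h0' : Win G ψ w₀ (ScheduleNP.core Sc 0) R ⊆ (s (0 : Fin (Sc.N + 1))).L.X 0 := h0
    intro ω hω
    unfold LData.reachB
    simp only [Set.mem_iUnion, exists_prop] at hω ⊢
    obtain ⟨t, ht, hωt⟩ := hω
    exact ⟨t, h0' (Finset.mem_coe.1 ht), by rw [ho0]; exact hωt⟩
  · have hlast' : T' (Fin.last Sc.N) = 𝒲.W (Sc.toFrame.core (Sc.N + 1)) := hlast
    rw [hlast']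
    intro u hu
    obtain ⟨hub, huC⟩ := (mem_Win (G := G) (φ := ψ)).1 hu
    exact hlastM u hub huC

/-- **The root leg with the ZONE AT THE ROOT AS THE SEED** (length exposed): in `rootChainF_of_schedN` take `Sw := Sd := Λc root kz` and `F :=` the
edges of `G` inside it — internally connected to the root (`hzconn`, `hcz`), wired by construction, pinned because the zone lies in the root cube
(`hZQ`: its inside edges are edges of `U₀ = edgesIn G Q₀`), in the world because `Q₀ ⊆ Q₀ ∪ E_{0,du}` and `hZR`.  Removes the nine seed binders
of the (R) wrapper in favour of two containment rows (design owner p3-g16). [cite: KozmaNitzan2024, §4 p. 27 (G₀: the wired cube), p. 28 ((32) at the root)] [this work] -/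
theorem rootChainF_of_schedNZ
    -- the scheme, the direction
    {A : Type*} {S : KSchA V A} (du : MDir)
    -- the skeleton map, the frame
    (hlipφ : Lip G φ) (hstep : Steps G φ) {Δ : ℕ} (hΔ : ∀ v, G.degree v ≤ Δ) {types : Finset V} (hfr : Frames G φ types) (hκ : CylConn G φ types)
    {n : ℕ} {hs : ℤ} (hn : 1 ≤ n) (c₀ : V) {σ : ℤ} (hσ : σ = 1 ∨ σ = -1) {kq : ℕ} (hκL : hs.natAbs ≤ kq * n)
    -- the schedule, the window
    (Sc : ScheduleNP) {w₀ : V} {R r : ℕ}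
    -- kit constants
    (Pk : ApronPrm) {Mz Rs KCmax rs cS cU : ℕ} (hPN : kq + 3 ≤ Pk.N) (hA : Pk.A = (Mz + 1 : ℕ) * (shearUnit n hs : ℤ) + 1)
    (hdD : Pk.d + 2 ≤ shellD Pk) (hDρ : Rs + 1 ≤ shellD Pk) (hKCmax : (shellD Pk + Mz + 1) * (kq + 1) ≤ KCmax)
    (hT : (shellD Pk : ℤ) + KCmax + Rs ≤ tanOff Pk.ℓs Pk.M)
    (hr₀ : Pk.N * (tanOff Pk.ℓs Pk.M + 2) + Pk.N * Pk.d + (KCmax + Rs) ≤ Pk.r₀) (hR : Pk.r₀ ≤ R)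
    (hrs : 1 + (Pk.N * (tanOff Pk.ℓs Pk.M + 2) + Pk.N * Pk.d + (KCmax + Rs)) ≤ rs)
    (hcS : (Pk.N + 1) * (tanOff Pk.ℓs Pk.M + 1) + (Pk.N + 1) * Pk.d + (KCmax + 1) + cU ≤ cS)
    (hreach : r + (Pk.N * (tanOff Pk.ℓs Pk.M + 1) + Pk.N * Pk.d + KCmax) ≤ Pk.r₀)
    -- the short region and the zone datum
    (Rg : V → Finset V) (hRg : ∀ c, ∀ u ∈ Rg c, u ∈ graphBall G c Rs) (hRgcard : ∀ c, (Rg c).card ≤ cU) (hcU1 : 1 ≤ cU)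
    (Λc : V → ℕ → Finset V) (kz : ℕ) (hΛRg : ∀ c, Λc c kz ⊆ Rg c) (hzconn : ∀ c, ∀ s ∈ Λc c kz, PathIn G (↑(Λc c kz) : Set V) c s)
    (hcz : ∀ c, c ∈ Λc c kz) {Rk : ℕ} (hkz : 1 ≤ kz) (hRk : cylRadMax G φ types kz (2 * KCmax) ≤ Rk) (hΛcyl : ∀ c, cylBallFin G φ c kz Rk ⊆ Λc c kz)
    -- the chain data (world `U' := (Q₀ ∪ E_{0,du}) ∩ B(w₀, R)`)
    (Pd : WinChainData V) (hPo : Pd.o = S.Γ.root) (hPS : Pd.Sfin = (S.U0root du).filter fun y => y ∈ graphBall G w₀ R)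
    (hj0 : tanOff Pk.ℓs Pk.M ≤ Pd.j₀) (hj : Pd.j₁ ≤ Pd.Rlev) (hRl : Pd.Rlev + 1 ≤ Sc.R')
    (hE : Pd.j₁ + (Pk.N * (tanOff Pk.ℓs Pk.M + 1) + Pk.N * Pk.d + KCmax) ≤ Sc.R')
    {Δ' : ℕ} {δ η : ℝ} (hδ : 0 < δ) (hη : η ≤ δ / 2)
    (kk : ℕ) (hN : kk * (Δ + 1) ^ (2 * rs) ≤ Pd.N) (hk : (1 - (S.p : ℝ) ^ (1 + Δ * cS + cS * cU)) ^ kk ≤ δ)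
    (hcount : 1 / (1 - (S.p : ℝ)) ^ (Δ' * Pd.N) ≤ δ * ((Finset.Icc Pd.j₀ Pd.j₁).card : ℝ))
    -- THE SEED := THE ZONE AT THE ROOT `Λc root kz` (internally connected by `hzconn`, contains the root by `hcz`): inside the root cube (so its
    -- inside edges are edges of the wired cube `U₀`) and inside the window ball; the hop prism `Qp` in the world; the hop into the first core window
    (hZQ : Λc S.Γ.root kz ⊆ S.Γ.Q S.Γ.a₀ 0) (hZR : ∀ u ∈ Λc S.Γ.root kz, u ∈ graphBall G w₀ R)
    {Qp : Finset V} (hQU : Qp ⊆ (S.U0root du).filter fun y => y ∈ graphBall G w₀ R)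
    (hlink : 1 - δ < (bondPercolation G S.p).real (linkIn (↑Qp : Set V) (Λc S.Γ.root kz) (Win G (runX φ c₀ n hs σ) w₀ (ScheduleNP.core Sc 0) R)))
    -- the world rows (vertex form): every region window lies in `Q₀ ∪ E_{0,du}` and clears the seed; the rim; depth; the arrival cube
    (hreg : ∀ k ≤ Sc.N, ∀ u ∈ graphBall G w₀ R, runX φ c₀ n hs σ u ∈ Sc.region k → u ∈ S.U0root du)
    (hdis : ∀ k ≤ Sc.N, Disjoint (Win G (runX φ c₀ n hs σ) w₀ (Sc.region k) R) (Λc S.Γ.root kz))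
    (hRim : ∀ k, Pd.Rim k ⊆ Win G (runX φ c₀ n hs σ) w₀ (Sc.region k) R)
    (hcover : ∀ k ≤ Sc.N, ∀ v ∈ Win G (runX φ c₀ n hs σ) w₀ (Sc.region k) R, v ∉ graphBall G w₀ (R - Pk.r₀) → v ∈ Pd.Rim k)
    (hTne : ∀ k ≤ Sc.N, (Win G (runX φ c₀ n hs σ) w₀ (ScheduleNP.core Sc (k + 1)) R).Nonempty)
    (hlastM : ∀ u ∈ graphBall G w₀ R, runX φ c₀ n hs σ u ∈ ScheduleNP.core Sc (Sc.N + 1) → u ∈ S.Γ.M S.Γ.a₀ ((0 : Site 2) + stepVec du))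
    (hexc : ∀ k ≤ Sc.N,
      (prodBernoulli (S.W0pin G (edgesIn G (Λc S.Γ.root kz)) ((S.U0root du).filter fun y => y ∈ graphBall G w₀ R))).real (⋃ t' ∈ Pd.Rim k, openConn S.Γ.root t') ≤ η)
    -- THE PER-STEP PER-CENTRE PARKED-OR-ROUTED INPUT under the root-seed law (for the K-G corridor: p5-g15's `hrouteSW_kgCorr(Y)`)
    (hrouteS : ∀ k ≤ Sc.N, ∀ c : V,
      runX φ c₀ n hs σ c ∈ Finset.Icc (Sc.lo k - ((Sc.R' : ℕ) : Site 2)) (Sc.hi k + ((Sc.R' : ℕ) : Site 2)) → c ∈ graphBall G w₀ (R - r) →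
      c ∈ Win G (runX φ c₀ n hs σ) w₀ (ScheduleNP.core Sc (k + 1)) R ∪ Pd.Rim k ∨
      ∃ Qt Ft : Finset V, Ft ⊆ Win G (runX φ c₀ n hs σ) w₀ (ScheduleNP.core Sc (k + 1)) R ∪ Pd.Rim k ∧
        Qt ⊆ Win G (runX φ c₀ n hs σ) w₀ (Sc.region k) R ∧
        1 - δ ^ 3 ≤ (prodBernoulli (S.W0pin G (edgesIn G (Λc S.Γ.root kz)) ((S.U0root du).filter fun y => y ∈ graphBall G w₀ R))).real
          (linkIn (↑Qt : Set V) (Λc c kz) Ft)) :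
    ∃ (c : V) (Rπ : ℕ) (W : Sym2 V → unitInterval) (s : Fin (Sc.N + 1) → KNLevels.TStep (winGraph G c Rπ))
      (T' : Fin (Sc.N + 1) → Finset V) (η' : ℝ),
      (∀ T : Finset V, (prodBernoulli W).real (⋃ t ∈ T, openConn S.Γ.root t) ≤
        (prodBernoulli (pinW (KNLevels.lattW G S.p) ↑(S.U₀ G) ↑(S.U₀ G))).real
          (⋃ t ∈ (↑T : Set V), openConnIn (↑(S.Γ.Q S.Γ.a₀ 0 ∪ S.Γ.Ewv S.Γ.a₀ 0 du) : Set V) S.Γ.root t)) ∧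
      (∀ i : Fin (Sc.N + 1), (s i).L.o = S.Γ.root) ∧
      (∀ i : Fin Sc.N, T' (Fin.castSucc i) ⊆ (s i.succ).L.X 0) ∧ (∀ i : Fin (Sc.N + 1), T' i ⊆ (s i).T) ∧
      (∀ i : Fin (Sc.N + 1), (s i).KitsAtF W S.p Δ' δ) ∧ η' ≤ δ / 2 ∧
      (∀ i : Fin (Sc.N + 1), (prodBernoulli W).real (⋃ t ∈ (s i).T \ T' i, openConn S.Γ.root t) ≤ η') ∧
      1 - δ < (prodBernoulli W).real (s 0).L.reachB ∧
      T' (Fin.last Sc.N) ⊆ S.Γ.M S.Γ.a₀ ((0 : Site 2) + stepVec du) := by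
  -- the seed data: pairs `F := edgesIn G (Λc root kz)`, vertices `Sw := Sd := Λc root kz`
  have hZU : Λc S.Γ.root kz ⊆ (S.U0root du).filter fun y => y ∈ graphBall G w₀ R := fun u hu =>
    Finset.mem_filter.2 ⟨Finset.mem_union_left _ (hZQ hu), hZR u hu⟩
  have hF : edgesIn G (Λc S.Γ.root kz) ⊆ S.U₀ G := fun e he => by
    rw [mem_edgesIn_iff] at he
    exact mem_edgesIn_iff.2 ⟨he.1, fun x hx => hZQ (he.2 x hx)⟩
  have hFSw : ∀ e ∈ edgesIn G (Λc S.Γ.root kz), ∀ w ∈ e, w ∈ Λc S.Γ.root kz := fun e he w hw => (mem_edgesIn_iff.1 he).2 w hw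
  have hwired : ∀ u ∈ Λc S.Γ.root kz, ∀ u' ∈ Λc S.Γ.root kz, G.Adj u u' → s(u, u') ∈ edgesIn G (Λc S.Γ.root kz) :=
    fun u hu u' hu' hadj => mem_edgesIn_iff.2 ⟨(SimpleGraph.mem_edgeSet G).2 hadj, fun x hx => by
      rcases Sym2.mem_iff.1 hx with rfl | rfl
      · exact hu
      · exact hu'⟩
  exact rootChainF_of_schedN du hlipφ hstep hΔ hfr hκ hn c₀ hσ hκL Sc Pk hPN hA hdD hDρ hKCmax hT hr₀ hR hrs hcS hreach Rg hRg hRgcard hcU1 Λc kz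
    hΛRg hzconn hcz hkz hRk hΛcyl Pd hPo hPS hj0 hj hRl hE hδ hη kk hN hk hcount hF hFSw hZU hQU subset_rfl (hzconn S.Γ.root) hwired
    (hcz S.Γ.root) hlink hreg hdis hRim hcover hTne hlastM hexc hrouteS

end Skelφ

end Transplant

end Summit.CriticalPhenomena.PercolationContinuityZ3.Theorems

end
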